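import Literature.Probability.RandomPlanarGeometry.HexSAWWinding
import Literature.Probability.RandomPlanarGeometry.HexSAWHexagonSurgery
import Mathlib.Analysis.SpecialFunctions.Pow.Real
import HarnessLib

/-!
# Density of hexagon deletion sites along self-avoiding walks on `ℍ`, from the runs of the turn word

Topic `Literature/Probability/RandomPlanarGeometry` (hexagonal-lattice self-avoiding walk; the entropy input of
Kesten's ratio argument, M–S §7.3, on `ℍ`). Sources: N. Madras, G. Slade, *The Self-Avoiding Walk*, Birkhäuser
(1993), §7.3 (proof of Theorem 7.3.2: the density of occurrences of the pattern `V` along all but exponentially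
few walks, there obtained from Kesten's pattern theorem, Theorem 7.2.3); H. Duminil-Copin, S. Smirnov, *The
connective constant of the honeycomb lattice equals `√(2+√2)`*, Ann. of Math. 175 (2012), Theorem 1 (tree theorem
`DuminilCopinSmirnov2012_thm1_holds`; only the lower bound `√(2+√2)^N ≤ c_N(ℍ)` is relevant downstream).
STATUS IN PRINT: the statement proved here (`DetourDensityHex` of `HexSAWHexagonSurgery`: all but
`C 2^{-⌊N/Q⌋} √(2+√2)^N` of the `N`-step walks on `ℍ` have more than `N/(4Q)` hexagon deletion sites) is the
honeycomb instance of the pattern-density input of M–S Theorem 7.3.2; it is not printed for `ℍ`, and the proof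
below is NOT the printed one: it uses no pattern theorem. WALK MODEL: the tree's coordinate honeycomb `hvGraph`
on `HV = ℤ × ℤ × Bool`, walks `sawLists hvGraph hvOrigin N` (vertex lists), deletion sites `hexSharp` of
`HexSAWHexagonSurgery` (`(m, v)` with `ω_m ~ v ~ ω_{m+4}`, `v ∉ ω`).

PROOF (lane «pcv-sawmu», bet A2 «HEX-RATIO-2», block K1′-ℍ; architecture a-idea-1's checked skeleton):
* §1 oriented hexagon frames (`hexW s h j`: the tree's `hexV` counterclockwise for a left letter, clockwise for a
  right letter): every dart bounds the face on its turn side (`exists_frame`, from the tree's `leftFace_eq_iff`),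
  a turn of the run's sign stays on the hexagon (`extend`, from `adj_hexV_iff` and `turn_ccw_hexExt`), turns are
  `±1` (`turn_eq_or`), and one letter of the turn word determines the next vertex (`eq_of_turn_eq`);
* §2 `run_frame`: `m+1` equal turns put `m+3` consecutive vertices on one hexagon;
* §3 runs of Boolean words, peeling the first run (`runs (c^{n+1} w) = (n+1) :: runs w`);
* §4 (S3) the tilted run count `Σ_{w ∈ capWords n} (1/10)^{R3 w} ≤ 2 · (178/100)^n` by the first-run transfer
  (`1/λ + 1/λ² + x/λ³ + 1/λ⁴ ≤ 1` at `x = 1/10`, `λ = 1.78`, certificate `run_certificate`);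
* §5 (S1) the code `ω ↦ (ω₁, turn word)` is injective, and five equal turns would close a hexagon, so the runs
  are capped at four (`runs_turnWord_le_four`, by peeling runs off the walk);
* §6 (S2) `R3 (turnWord ω) ≤ #hexSharp ω + 6`: a maximal run of exactly three equal turns goes around a hexagon
  whose sixth vertex `z` is adjacent to `ω_k` and `ω_{k+4}`; if `z = ω_m` is an interior vertex, its two
  walk-neighbours are among `ω_k, ω_{k+4}` and the exterior neighbour of `z`, and each case extends the run or
  identifies two distinct hexagon vertices (`core`); endpoints account for at most `3 + 3` indices;
* §7 Markov at level `N/200 + 6`, the numeric input `(1.78)^200 · 10 · 16 ≤ √(2+√2)^200`, composition with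
  `Q = 50`, `C = 8·10⁶` (a-idea-1's skeleton with the S3 constant `2`).
-/

noncomputable section

open Finset Literature.Probability.LatticeModels Literature.Probability.Percolation
open scoped Fin.NatCast Fin.CommRing

namespace Literature.Probability.RandomPlanarGeometry.SAW.HV


/-! ### Vocabulary: the turn word and its runs -/

/-- The turn word of a vertex list: letter `p` is `true` iff the turn at the interior vertex `p+1` is a left
turn. [cite: DuminilCopinSmirnov2012, §2 (winding = total rotation; on `ℍ` every turn is `±π/3`)] -/
def turnWord : List HV → List Bool
  | u :: v :: w :: t => decide (0 < turn u v w) :: turnWord (v :: w :: t)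
  | _ => []

/-- The lengths of the maximal runs of equal letters of a Boolean word. [cite: MadrasSlade1993, §7.3 p. 244] -/
def runs : List Bool → List ℕ
  | [] => []
  | [_] => [1]
  | b :: c :: t =>
      if b = c then (match runs (c :: t) with
        | [] => [1]
        | r :: rs => (r + 1) :: rs)
      else 1 :: runs (c :: t)

/-- The number of maximal runs of length exactly three (three equal turns = four edges around one hexagon).
[cite: MadrasSlade1993, §7.3 p. 244 (the pattern `V`)] -/
def R3 (w : List Bool) : ℕ := (runs w).count 3

/-- The Boolean words of length `n` all of whose maximal runs have length at most four.
[cite: MadrasSlade1993, §7.3 p. 244] -/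
def capWords (n : ℕ) : Finset (List Bool) :=
  (listsLen ({true, false} : Finset Bool) n).filter fun w => ∀ r ∈ runs w, r ≤ 4

/-- The possible second vertices of a walk from the origin (`none` for the zero-step walk).
[cite: MadrasSlade1993, §1.2] -/
def firstOpts : Finset (Option HV) := insert none ((nbrs hvOrigin).map some).toFinset

namespace RunDensity

/-! ### §1 Oriented hexagon frames -/

/-- The sign of a turn letter: `+1` for `true` (left), `-1` for `false` (right). [folklore] -/
def sgn (s : Bool) : ℤ := if s then 1 else -1

/-- The vertices of the hexagon `h` in the orientation `s` (counterclockwise for `true`). [folklore] -/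
def hexW (s : Bool) (h : ℤ × ℤ) (j : Fin 6) : HV := if s then hexV h j else hexV h (-j)

/-- The exterior neighbour of the `j`-th oriented vertex. [folklore] -/
def hexWExt (s : Bool) (h : ℤ × ℤ) (j : Fin 6) : HV := if s then hexExt h j else hexExt h (-j)

/-- The face on the `s`-side of a dart. [folklore] -/
def faceOf (s : Bool) (u v : HV) : ℤ × ℤ := if s then leftFace u v else rightFace u v

variable {s : Bool} {h : ℤ × ℤ}

/-- Consecutive oriented vertices are adjacent. [folklore] -/
private theorem adj_hexW_succ (s : Bool) (h : ℤ × ℤ) (j : Fin 6) : hvGraph.Adj (hexW s h j) (hexW s h (j + 1)) := by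
  cases s
  · simp only [hexW, Bool.false_eq_true, ↓reduceIte]
    have := adj_hexV_succ h (-(j + 1))
    rw [show -(j + 1) + 1 = -j by ring] at this
    exact this.symm
  · simpa only [hexW, ↓reduceIte] using adj_hexV_succ h j

/-- The turn along the oriented hexagon is `sgn s`. [folklore] -/
private theorem turn_hexW (s : Bool) (h : ℤ × ℤ) (j : Fin 6) :
    turn (hexW s h (j - 1)) (hexW s h j) (hexW s h (j + 1)) = sgn s := by
  cases s
  · simp only [hexW, sgn, Bool.false_eq_true, ↓reduceIte]
    rw [show -(j - 1) = -j + 1 by ring, show -(j + 1) = -j - 1 by ring]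
    exact turn_hexV_cw h (-j)
  · simpa only [hexW, sgn, ↓reduceIte] using turn_hexV_ccw h j

/-- Leaving the oriented hexagon is the opposite turn. [folklore] -/
private theorem turn_hexW_ext (s : Bool) (h : ℤ × ℤ) (j : Fin 6) :
    turn (hexW s h (j - 1)) (hexW s h j) (hexWExt s h j) = -sgn s := by
  cases s
  · simp only [hexW, hexWExt, sgn, Bool.false_eq_true, ↓reduceIte, neg_neg]
    rw [show -(j - 1) = -j + 1 by ring]
    exact turn_cw_hexExt h (-j)
  · simpa only [hexW, hexWExt, sgn, ↓reduceIte] using turn_ccw_hexExt h j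

/-- The three neighbours of an oriented hexagon vertex. [folklore] -/
private theorem adj_hexW_iff (s : Bool) (h : ℤ × ℤ) (j : Fin 6) (x : HV) :
    hvGraph.Adj (hexW s h j) x ↔ x = hexW s h (j + 1) ∨ x = hexW s h (j - 1) ∨ x = hexWExt s h j := by
  cases s
  · simp only [hexW, hexWExt, Bool.false_eq_true, ↓reduceIte]
    rw [adj_hexV_iff, show -(j + 1) = -j - 1 by ring, show -(j - 1) = -j + 1 by ring]
    tauto
  · simp only [hexW, hexWExt, ↓reduceIte]
    exact adj_hexV_iff h j x

/-- Oriented vertices are distinct. [folklore] -/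
private theorem hexW_injective (s : Bool) (h : ℤ × ℤ) : Function.Injective (hexW s h) := by
  intro j j' e
  cases s
  · simp only [hexW, Bool.false_eq_true, ↓reduceIte] at e
    exact neg_injective (hexV_injective h e)
  · simp only [hexW, ↓reduceIte] at e
    exact hexV_injective h e

/-- Exterior neighbours are off the hexagon. [folklore] -/
private theorem hexWExt_ne_hexW (s : Bool) (h : ℤ × ℤ) (j j' : Fin 6) : hexWExt s h j ≠ hexW s h j' := by
  cases s
  · simpa only [hexW, hexWExt, Bool.false_eq_true, ↓reduceIte] using hexExt_ne_hexV h (-j) (-j')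
  · simpa only [hexW, hexWExt, ↓reduceIte] using hexExt_ne_hexV h j j'

/-- `sgn s ≠ -sgn s`. [folklore] -/
private theorem sgn_ne_neg (s : Bool) : sgn s ≠ -sgn s := by cases s <;> decide

/-- Every dart is a boundary dart of the face on its `s`-side, in the orientation `s`. [folklore] -/
private theorem exists_frame {u v : HV} (huv : hvGraph.Adj u v) (s : Bool) :
    ∃ j : Fin 6, u = hexW s (faceOf s u v) j ∧ v = hexW s (faceOf s u v) (j + 1) := by
  cases s
  · obtain ⟨k, hu, hv⟩ := (rightFace_eq_iff huv (rightFace u v)).1 rfl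
    refine ⟨-(k + 1), ?_, ?_⟩
    · simpa only [hexW, faceOf, Bool.false_eq_true, ↓reduceIte, neg_neg] using hu
    · simp only [hexW, faceOf, Bool.false_eq_true, ↓reduceIte]
      rw [show -(-(k + 1) + 1) = k by ring]; exact hv
  · obtain ⟨k, hu, hv⟩ := (leftFace_eq_iff huv (leftFace u v)).1 rfl
    exact ⟨k, by simpa only [hexW, faceOf, ↓reduceIte] using hu, by simpa only [hexW, faceOf, ↓reduceIte] using hv⟩

/-- **Extension along a frame**: after two oriented boundary vertices, a turn of sign `sgn s` stays on the
hexagon. [folklore] -/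
private theorem extend {u v w : HV} {j : Fin 6} (hu : u = hexW s h j) (hv : v = hexW s h (j + 1))
    (hvw : hvGraph.Adj v w) (huw : u ≠ w) (ht : turn u v w = sgn s) : w = hexW s h (j + 2) := by
  rw [hv, adj_hexW_iff] at hvw
  rcases hvw with e | e | e
  · rw [e, show j + 1 + 1 = j + 2 by ring]
  · rw [e, show j + 1 - 1 = j by ring] at huw; exact absurd hu huw
  · have key := turn_hexW_ext s h (j + 1)
    rw [show j + 1 - 1 = j by ring] at key
    rw [hu, hv, e, key] at ht
    exact absurd ht.symm (sgn_ne_neg s)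

/-- **Turns are `±1`** along a genuine two-step path. [folklore] -/
private theorem turn_eq_or {u v w : HV} (huv : hvGraph.Adj u v) (hvw : hvGraph.Adj v w) (huw : u ≠ w) :
    turn u v w = 1 ∨ turn u v w = -1 := by
  obtain ⟨j, hu, hv⟩ := exists_frame huv true
  set h := faceOf true u v
  rw [hv, adj_hexW_iff] at hvw
  rcases hvw with e | e | e
  · left
    have key := turn_hexW true h (j + 1)
    rw [show j + 1 - 1 = j by ring] at key
    rw [hu, hv, e, key]; rfl
  · rw [e, show j + 1 - 1 = j by ring] at huw; exact absurd hu huw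
  · right
    have key := turn_hexW_ext true h (j + 1)
    rw [show j + 1 - 1 = j by ring] at key
    rw [hu, hv, e, key]; rfl

/-- The turn letter determines the turn. [folklore] -/
private theorem turn_eq_sgn {u v w : HV} (huv : hvGraph.Adj u v) (hvw : hvGraph.Adj v w) (huw : u ≠ w) {c : Bool}
    (hc : decide (0 < turn u v w) = c) : turn u v w = sgn c := by
  rcases turn_eq_or huv hvw huw with e | e <;> rw [e] at hc ⊢ <;> simp at hc <;> subst hc <;> rfl

/-- **The turn word is a faithful code, one step at a time.** [folklore] -/
private theorem eq_of_turn_eq {u v w w' : HV} (huv : hvGraph.Adj u v) (hvw : hvGraph.Adj v w) (hvw' : hvGraph.Adj v w')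
    (huw : u ≠ w) (huw' : u ≠ w') (ht : decide (0 < turn u v w) = decide (0 < turn u v w')) : w = w' := by
  set c := decide (0 < turn u v w')
  have h1 := turn_eq_sgn huv hvw huw ht
  have h2 := turn_eq_sgn huv hvw' huw' (rfl : decide (0 < turn u v w') = c)
  obtain ⟨j, hu, hv⟩ := exists_frame huv c
  rw [extend hu hv hvw huw h1, extend hu hv hvw' huw' h2]

/-! ### §2 Vertex access, the letters of the turn word, runs of equal turns -/

section Access

variable {l : List HV}

/-- Consecutive vertices of a chain are adjacent. [folklore] -/
private theorem adj_getD (hc : l.IsChain hvGraph.Adj) {i : ℕ} (hi : i + 1 < l.length) :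
    hvGraph.Adj (l.getD i hvOrigin) (l.getD (i + 1) hvOrigin) := by
  have := List.isChain_iff_getElem.1 hc i hi
  rwa [List.getElem_eq_getD hvOrigin, List.getElem_eq_getD hvOrigin] at this

/-- Vertex access is injective on a list without repetition. [folklore] -/
private theorem getD_inj (hn : l.Nodup) {i j : ℕ} (hi : i < l.length) (hj : j < l.length)
    (e : l.getD i hvOrigin = l.getD j hvOrigin) : i = j := by
  rw [← List.getElem_eq_getD (h := hi), ← List.getElem_eq_getD (h := hj)] at e
  exact (List.Nodup.getElem_inj_iff hn).1 e

/-- Accessed vertices are visited. [folklore] -/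
private theorem getD_mem {i : ℕ} (hi : i < l.length) : l.getD i hvOrigin ∈ l := by
  rw [← List.getElem_eq_getD (h := hi)]; exact List.getElem_mem hi

/-- Visited vertices are accessed. [folklore] -/
private theorem exists_getD_eq_of_mem {x : HV} (hx : x ∈ l) : ∃ i < l.length, l.getD i hvOrigin = x := by
  obtain ⟨i, hi, e⟩ := List.mem_iff_getElem.1 hx
  exact ⟨i, hi, by rw [← List.getElem_eq_getD (h := hi)]; exact e⟩

/-- In a chain without repetition the vertices two apart are distinct. [folklore] -/
private theorem getD_ne_getD_add_two (hn : l.Nodup) {i : ℕ} (hi : i + 2 < l.length) :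
    l.getD i hvOrigin ≠ l.getD (i + 2) hvOrigin := fun e =>
  absurd (getD_inj hn (by omega) hi e) (by omega)

end Access

/-- The length of the turn word. [folklore] -/
private theorem length_turnWord : ∀ l : List HV, (turnWord l).length = l.length - 2
  | [] => rfl
  | [_] => rfl
  | [_, _] => rfl
  | u :: v :: w :: t => by
    rw [turnWord, List.length_cons, length_turnWord (v :: w :: t)]
    simp

/-- The letters of the turn word. [folklore] -/
private theorem getElem?_turnWord : ∀ (l : List HV) (p : ℕ), p + 2 < l.length →
    (turnWord l)[p]? = some (decide (0 < turn (l.getD p hvOrigin) (l.getD (p + 1) hvOrigin)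
      (l.getD (p + 2) hvOrigin)))
  | [], _, h => by simp at h
  | [_], _, h => by simp at h
  | [_, _], _, h => by simp at h
  | u :: v :: w :: t, 0, _ => by simp [turnWord]
  | u :: v :: w :: t, p + 1, h => by
    rw [turnWord, List.getElem?_cons_succ, getElem?_turnWord (v :: w :: t) p (by simpa using h)]
    simp

/-- The turn word of a suffix is the suffix of the turn word. [folklore] -/
private theorem turnWord_drop : ∀ (l : List HV) (k : ℕ), turnWord (l.drop k) = (turnWord l).drop k
  | _, 0 => by simp
  | [], k + 1 => by simp [turnWord]
  | [_], k + 1 => by simp [turnWord]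
  | [_, v], k + 1 => by cases k <;> simp [turnWord]
  | u :: v :: w :: t, k + 1 => by
    rw [List.drop_succ_cons, turnWord_drop (v :: w :: t) k, turnWord, List.drop_succ_cons]

section Frames

variable {l : List HV} {s : Bool}

/-- **A run of equal turns goes around one hexagon**: if the turns at the vertices `k+1, …, k+m+1` all have
the letter `s`, the vertices `k, …, k+m+2` are consecutive boundary vertices of the face `faceOf s ω_k ω_{k+1}`
in the orientation `s`. [folklore] -/
private theorem run_frame (hc : l.IsChain hvGraph.Adj) (hn : l.Nodup) (k : ℕ) :
    ∀ m : ℕ, k + m + 2 < l.length → (∀ q ≤ m, (turnWord l)[k + q]? = some s) →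
      ∃ j : Fin 6, ∀ q ≤ m + 2,
        l.getD (k + q) hvOrigin = hexW s (faceOf s (l.getD k hvOrigin) (l.getD (k + 1) hvOrigin)) (j + q)
  | 0, hk, ht => by
    have huv := adj_getD hc (i := k) (by omega)
    have hvw := adj_getD hc (i := k + 1) (by omega)
    have huw := getD_ne_getD_add_two hn (i := k) (by omega)
    have h0 := ht 0 le_rfl
    rw [add_zero, getElem?_turnWord l k (by omega), Option.some.injEq] at h0
    have hturn := turn_eq_sgn huv hvw huw h0
    obtain ⟨j, hu, hv⟩ := exists_frame huv s
    have hw := extend hu hv hvw huw hturn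
    refine ⟨j, fun q hq => ?_⟩
    interval_cases q
    · simpa using hu
    · simpa using hv
    · simpa using hw
  | m + 1, hk, ht => by
    obtain ⟨j, hj⟩ := run_frame hc hn k m (by omega) fun q hq => ht q (by omega)
    refine ⟨j, fun q hq => ?_⟩
    rcases Nat.lt_or_ge q (m + 3) with hq' | hq'
    · exact hj q (by omega)
    obtain rfl : q = m + 3 := le_antisymm hq hq'
    have hu := hj (m + 1) (by omega)
    have hv := hj (m + 2) le_rfl
    have e1 : j + ((m + 1 : ℕ) : Fin 6) + 1 = j + ((m + 2 : ℕ) : Fin 6) := by push_cast; ring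
    rw [← e1] at hv
    have huv : hvGraph.Adj (l.getD (k + (m + 1)) hvOrigin) (l.getD (k + (m + 2)) hvOrigin) := by
      have := adj_getD hc (i := k + (m + 1)) (by omega)
      rwa [show k + (m + 1) + 1 = k + (m + 2) by omega] at this
    have hvw : hvGraph.Adj (l.getD (k + (m + 2)) hvOrigin) (l.getD (k + (m + 3)) hvOrigin) := by
      have := adj_getD hc (i := k + (m + 2)) (by omega)
      rwa [show k + (m + 2) + 1 = k + (m + 3) by omega] at this
    have huw : l.getD (k + (m + 1)) hvOrigin ≠ l.getD (k + (m + 3)) hvOrigin := by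
      have := getD_ne_getD_add_two hn (i := k + (m + 1)) (by omega)
      rwa [show k + (m + 1) + 2 = k + (m + 3) by omega] at this
    have h0 := ht (m + 1) le_rfl
    rw [getElem?_turnWord l (k + (m + 1)) (by omega), Option.some.injEq,
      show k + (m + 1) + 1 = k + (m + 2) by omega, show k + (m + 1) + 2 = k + (m + 3) by omega] at h0
    rw [extend hu hv hvw huw (turn_eq_sgn huv hvw huw h0)]
    congr 1
    push_cast; ring

end Frames

/-! ### §3 Runs of a Boolean word: peeling the first run -/

section Runs

/-- The length of the initial run of the letter `c`. [folklore] -/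
def runLen (c : Bool) : List Bool → ℕ
  | [] => 0
  | a :: t => if a = c then runLen c t + 1 else 0

/-- The initial run is not longer than the word. [folklore] -/
private theorem runLen_le_length (c : Bool) : ∀ w : List Bool, runLen c w ≤ w.length
  | [] => by simp [runLen]
  | a :: t => by
    have := runLen_le_length c t
    by_cases h : a = c <;> simp [runLen, h] ; omega

/-- A word is its initial `c`-run followed by the rest. [folklore] -/
private theorem eq_replicate_runLen_append (c : Bool) :
    ∀ w : List Bool, w = List.replicate (runLen c w) c ++ w.drop (runLen c w)
  | [] => by simp [runLen]
  | a :: t => by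
    by_cases h : a = c
    · subst h
      simp only [runLen, ↓reduceIte, List.replicate_succ, List.cons_append, List.drop_succ_cons]
      exact congrArg _ (eq_replicate_runLen_append a t)
    · simp [runLen, h]

/-- After the initial `c`-run the word does not continue with `c`. [folklore] -/
private theorem head?_drop_runLen (c : Bool) : ∀ w : List Bool, (w.drop (runLen c w)).head? ≠ some c
  | [] => by simp [runLen]
  | a :: t => by
    by_cases h : a = c
    · subst h
      simp only [runLen, ↓reduceIte, List.drop_succ_cons]
      exact head?_drop_runLen a t
    · simp [runLen, h]

/-- A word starting with `c` has a positive initial `c`-run. [folklore] -/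
private theorem one_le_runLen {c : Bool} {w : List Bool} (h : w.head? = some c) : 1 ≤ runLen c w := by
  cases w with
  | nil => simp at h
  | cons a t =>
    simp only [List.head?_cons, Option.some.injEq] at h
    subst h; simp [runLen]

/-- `runs` of a nonempty word is nonempty (and a cons). [folklore] -/
private theorem runs_cons_eq_cons (a : Bool) : ∀ t : List Bool, ∃ r rs, runs (a :: t) = r :: rs
  | [] => ⟨1, [], rfl⟩
  | b :: t => by
    obtain ⟨r, rs, e⟩ := runs_cons_eq_cons b t
    by_cases h : a = b
    · subst h
      exact ⟨r + 1, rs, by simp [runs, e]⟩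
    · exact ⟨1, runs (b :: t), by simp [runs, h]⟩

/-- **Peeling the first run**: `runs (c^{n+1} w) = (n+1) :: runs w` when `w` does not start with `c`.
[folklore] -/
private theorem runs_replicate_succ_append (c : Bool) : ∀ (n : ℕ) (w : List Bool), w.head? ≠ some c →
    runs (List.replicate (n + 1) c ++ w) = (n + 1) :: runs w
  | 0, [], _ => by simp [runs]
  | 0, d :: t, h => by
    have hd : c ≠ d := fun e => h (by simp [e])
    simp [runs, hd]
  | n + 1, w, h => by
    have ih := runs_replicate_succ_append c n w h
    simp only [List.replicate_succ, List.cons_append] at ih ⊢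
    simp [runs, ih]

/-- The first run of a word starting with `c`: `runs w = runLen c w :: runs (rest)`. [folklore] -/
private theorem runs_eq_runLen_cons {c : Bool} {w : List Bool} (h : w.head? = some c) :
    runs w = runLen c w :: runs (w.drop (runLen c w)) := by
  have h1 := one_le_runLen h
  have key := runs_replicate_succ_append c (runLen c w - 1) (w.drop (runLen c w)) (head?_drop_runLen c w)
  rw [show runLen c w - 1 + 1 = runLen c w by omega, ← eq_replicate_runLen_append c w] at key
  exact key

end Runs

/-! ### §4 The tilted run count over capped words (stub S3 of the skeleton, constant `2`) -/

section GF

/-- Membership in `capWords`. [folklore] -/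
private theorem mem_capWords {n : ℕ} {w : List Bool} : w ∈ capWords n ↔ w.length = n ∧ ∀ r ∈ runs w, r ≤ 4 := by
  simp only [capWords, mem_filter, mem_listsLen_iff, and_assoc]
  constructor
  · rintro ⟨h1, -, h3⟩; exact ⟨h1, h3⟩
  · rintro ⟨h1, h3⟩; exact ⟨h1, fun x _ => by cases x <;> simp, h3⟩

/-- The capped words of length `n` that do not start with the letter `b`. [folklore] -/
def avoidHead (n : ℕ) (b : Bool) : Finset (List Bool) := (capWords n).filter fun w => w.head? ≠ some b

/-- Membership in `avoidHead`. [folklore] -/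
private theorem mem_avoidHead {n : ℕ} {b : Bool} {w : List Bool} :
    w ∈ avoidHead n b ↔ (w.length = n ∧ ∀ r ∈ runs w, r ≤ 4) ∧ w.head? ≠ some b := by
  rw [avoidHead, mem_filter, mem_capWords]

/-- For nonnegative summands the sum over a union is at most the sum of the sums. [folklore] -/
private theorem sum_union_le_add {α : Type*} [DecidableEq α] (a b : Finset α) {f : α → ℝ} (hf : ∀ x, 0 ≤ f x) :
    ∑ x ∈ a ∪ b, f x ≤ ∑ x ∈ a, f x + ∑ x ∈ b, f x := by
  rw [← Finset.sum_union_inter]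
  have : 0 ≤ ∑ x ∈ a ∩ b, f x := Finset.sum_nonneg fun x _ => hf x
  linarith

/-- The numeric certificate of the run recursion at `x = 1/10`, `λ = 178/100`:
`Σ_{r=1}^{min(4,n)} x^{[r=3]} λ^{n-r} ≤ λ^n` for `n ≥ 1`. [folklore] -/
private theorem run_certificate (n : ℕ) (hn : 1 ≤ n) :
    ∑ r ∈ Finset.Icc 1 4, (if r ≤ n then (1 / 10 : ℝ) ^ (if r = 3 then 1 else 0) * (178 / 100 : ℝ) ^ (n - r)
      else 0) ≤ (178 / 100 : ℝ) ^ n := by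
  rw [show Finset.Icc 1 4 = {1, 2, 3, 4} from by decide, Finset.sum_insert (by decide),
    Finset.sum_insert (by decide), Finset.sum_insert (by decide), Finset.sum_singleton]
  rcases Nat.lt_or_ge n 4 with h4 | h4
  · interval_cases n <;> norm_num
  · obtain ⟨m, rfl⟩ : ∃ m, n = m + 4 := ⟨n - 4, by omega⟩
    have e1 : m + 4 - 1 = m + 3 := by omega
    have e2 : m + 4 - 2 = m + 2 := by omega
    have e3 : m + 4 - 3 = m + 1 := by omega
    have e4 : m + 4 - 4 = m := by omega
    simp only [show 1 ≤ m + 4 from by omega, show 2 ≤ m + 4 from by omega, show 3 ≤ m + 4 from by omega,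
      show 4 ≤ m + 4 from by omega, ↓reduceIte, e1, e2, e3, e4, pow_add]
    norm_num
    have h0 : (0 : ℝ) ≤ (89 / 50 : ℝ) ^ m := by positivity
    nlinarith [h0]

/-- **S3′**: `Σ_{w ∈ avoidHead n b} x^{R3 w} ≤ λ^n` by peeling the first run (`x = 1/10`, `λ = 1.78`).
[folklore] -/
private theorem sum_avoidHead_le : ∀ (n : ℕ) (b : Bool),
    ∑ w ∈ avoidHead n b, (1 / 10 : ℝ) ^ R3 w ≤ (178 / 100 : ℝ) ^ n := by
  intro n
  induction n using Nat.strong_induction_on with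
  | _ n ih =>
  intro b
  rcases Nat.eq_zero_or_pos n with rfl | hn
  · -- only the empty word
    have hsub : avoidHead 0 b ⊆ {[]} := by
      intro w hw
      rw [mem_avoidHead] at hw
      rw [Finset.mem_singleton, ← List.length_eq_zero_iff]; exact hw.1.1
    refine (Finset.sum_le_sum_of_subset_of_nonneg hsub fun _ _ _ => by positivity).trans ?_
    simp [R3, runs]
  set c := !b with hc
  -- every word in `avoidHead n b` starts with `c` and has first run length in `[1, 4]`
  have hstart : ∀ w ∈ avoidHead n b, w.head? = some c := by
    intro w hw
    rw [mem_avoidHead] at hw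
    cases w with
    | nil => simp at hw; omega
    | cons a t =>
      simp only [List.head?_cons, Option.some.injEq, ne_eq] at hw ⊢
      cases a <;> cases b <;> simp_all
  have hmaps : ∀ w ∈ avoidHead n b, runLen c w ∈ Finset.Icc 1 4 := by
    intro w hw
    have h1 := one_le_runLen (hstart w hw)
    have hr := runs_eq_runLen_cons (hstart w hw)
    rw [mem_avoidHead] at hw
    exact Finset.mem_Icc.2 ⟨h1, hw.1.2 _ (by rw [hr]; exact List.mem_cons_self)⟩
  rw [← Finset.sum_fiberwise_of_maps_to hmaps]
  refine le_trans (Finset.sum_le_sum fun r hr => ?_) (run_certificate n hn)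
  -- the fiber of first-run length `r`
  have hr1 : 1 ≤ r := (Finset.mem_Icc.1 hr).1
  by_cases hrn : r ≤ n
  · rw [if_pos hrn]
    set Ar := (avoidHead n b).filter fun w => runLen c w = r with hAr
    have hmemAr : ∀ w ∈ Ar, w = List.replicate r c ++ w.drop r ∧ runs w = r :: runs (w.drop r) ∧
        w.drop r ∈ avoidHead (n - r) c := by
      intro w hw
      rw [hAr, mem_filter] at hw
      obtain ⟨hw, hwr⟩ := hw
      have h1 := eq_replicate_runLen_append c w
      have h2 := runs_eq_runLen_cons (hstart w hw)
      have h3 := head?_drop_runLen c w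
      rw [hwr] at h1 h2 h3
      rw [mem_avoidHead] at hw
      refine ⟨h1, h2, mem_avoidHead.2 ⟨⟨by rw [List.length_drop, hw.1.1], fun q hq => hw.1.2 q ?_⟩, h3⟩⟩
      rw [h2]; exact List.mem_cons_of_mem _ hq
    have hpt : ∀ w ∈ Ar, (1 / 10 : ℝ) ^ R3 w =
        (1 / 10 : ℝ) ^ (if r = 3 then 1 else 0) * (1 / 10 : ℝ) ^ R3 (w.drop r) := by
      intro w hw
      obtain ⟨-, h2, -⟩ := hmemAr w hw
      rw [R3, h2, List.count_cons, R3, pow_add, mul_comm]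
      congr 2
      by_cases h : r = 3 <;> simp [h]
    have hinj : Set.InjOn (fun w : List Bool => w.drop r) Ar := by
      intro w₁ h₁ w₂ h₂ e
      rw [(hmemAr w₁ h₁).1, (hmemAr w₂ h₂).1]
      simp only at e; rw [e]
    have himg : ∑ w ∈ Ar, (1 / 10 : ℝ) ^ R3 (w.drop r) =
        ∑ y ∈ Ar.image (fun w : List Bool => w.drop r), (1 / 10 : ℝ) ^ R3 y :=
      (Finset.sum_image (f := fun y : List Bool => (1 / 10 : ℝ) ^ R3 y) hinj).symm
    rw [Finset.sum_congr rfl hpt, ← Finset.mul_sum, himg]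
    refine mul_le_mul_of_nonneg_left ?_ (by positivity)
    refine le_trans (Finset.sum_le_sum_of_subset_of_nonneg ?_ fun _ _ _ => by positivity)
      (ih (n - r) (by omega) c)
    intro y hy
    rw [Finset.mem_image] at hy
    obtain ⟨w, hw, rfl⟩ := hy
    exact (hmemAr w hw).2.2
  · -- `r > n`: the fiber is empty
    rw [if_neg hrn]
    have : ((avoidHead n b).filter fun w => runLen c w = r) = ∅ := by
      rw [Finset.filter_eq_empty_iff]
      intro w hw e
      have := runLen_le_length c w
      rw [mem_avoidHead] at hw
      omega
    rw [this, Finset.sum_empty]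

/-- **S3 «tilted run count»**: `Σ_{w ∈ capWords n} (1/10)^{R3 w} ≤ 2 · (178/100)^n`.
[cite: MadrasSlade1993, §7.3 p. 244 (counting occurrences of the pattern `V`; here by a run transfer)] -/
theorem sum_pow_R3_le (n : ℕ) : ∑ w ∈ capWords n, (1 / 10 : ℝ) ^ R3 w ≤ 2 * (178 / 100 : ℝ) ^ n := by
  have hsub : capWords n ⊆ avoidHead n true ∪ avoidHead n false := by
    intro w hw
    rw [Finset.mem_union, avoidHead, avoidHead, mem_filter, mem_filter]
    cases hh : w.head? with
    | none => left; exact ⟨hw, by simp⟩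
    | some a =>
      cases a
      · left; exact ⟨hw, by simp⟩
      · right; exact ⟨hw, by simp⟩
  calc ∑ w ∈ capWords n, (1 / 10 : ℝ) ^ R3 w
      ≤ ∑ w ∈ avoidHead n true ∪ avoidHead n false, (1 / 10 : ℝ) ^ R3 w :=
        Finset.sum_le_sum_of_subset_of_nonneg hsub fun _ _ _ => by positivity
    _ ≤ ∑ w ∈ avoidHead n true, (1 / 10 : ℝ) ^ R3 w + ∑ w ∈ avoidHead n false, (1 / 10 : ℝ) ^ R3 w :=
        sum_union_le_add _ _ fun _ => by positivity
    _ ≤ (178 / 100 : ℝ) ^ n + (178 / 100 : ℝ) ^ n := add_le_add (sum_avoidHead_le n true) (sum_avoidHead_le n false)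
    _ = 2 * (178 / 100 : ℝ) ^ n := by ring

end GF

/-! ### §5 The turn-word code (stub S1): injective, second vertex in `firstOpts`, runs capped at four -/

section Code

/-- **Self-avoidance caps the runs of equal turns at four** (five equal turns close a hexagon). [folklore] -/
private theorem runs_turnWord_le_four : ∀ (n : ℕ) (l : List HV), l.length ≤ n → l.IsChain hvGraph.Adj → l.Nodup →
    ∀ r ∈ runs (turnWord l), r ≤ 4
  | 0, l, hl, _, _ => by
    have : l = [] := List.eq_nil_of_length_eq_zero (by omega)
    subst this; simp [turnWord, runs]
  | n + 1, l, hl, hc, hn => by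
    by_cases h0 : turnWord l = []
    · rw [h0]; simp [runs]
    obtain ⟨c, hc'⟩ : ∃ c, (turnWord l).head? = some c := by
      cases h : turnWord l with
      | nil => exact absurd h h0
      | cons a t => exact ⟨a, rfl⟩
    have hruns := runs_eq_runLen_cons hc'
    set t := turnWord l with htdef
    set r := runLen c t with hrdef
    have hr1 : 1 ≤ r := one_le_runLen hc'
    have hrt : r ≤ t.length := runLen_le_length c t
    have htl : t.length = l.length - 2 := length_turnWord l
    intro q hq
    rw [hruns, List.mem_cons] at hq
    rcases hq with rfl | hq
    · -- the first run: five equal turns would put `ω_0, …, ω_6` on one hexagon, `ω_0 = ω_6`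
      by_contra h5
      have hsplit := eq_replicate_runLen_append c t
      rw [← hrdef] at hsplit
      have letters : ∀ q ≤ 4, (turnWord l)[0 + q]? = some c := by
        intro q hq
        rw [← htdef, hsplit, zero_add, List.getElem?_append_left (by simp; omega), List.getElem?_replicate]
        simp; omega
      obtain ⟨j, hj⟩ := run_frame hc hn 0 4 (by omega) letters
      have e0 := hj 0 (by norm_num)
      have e6 := hj 6 (by norm_num)
      rw [show ((6 : ℕ) : Fin 6) = ((0 : ℕ) : Fin 6) by decide, ← e0] at e6
      have := getD_inj hn (by omega) (by omega) e6
      omega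
    · -- later runs: induction on the suffix
      rw [htdef, ← turnWord_drop] at hq
      exact runs_turnWord_le_four n (l.drop r) (by rw [List.length_drop]; omega) (hc.drop r)
        (hn.sublist (List.drop_sublist r l)) q hq

variable {N : ℕ} {l : List HV}

/-- The first vertex of a walk from the origin. [folklore] -/
private theorem getD_zero_of_mem (hl : l ∈ sawLists hvGraph hvOrigin N) : l.getD 0 hvOrigin = hvOrigin := by
  rw [List.getD_eq_getElem?_getD, ← List.head?_eq_getElem?, (mem_sawLists_iff.1 hl).2.1]; rfl

/-- **The turn-word code is injective** on the `N`-step walks from the origin. [folklore] -/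
private theorem code_injOn (N : ℕ) :
    Set.InjOn (fun l : List HV => (l[1]?, turnWord l)) (sawLists hvGraph hvOrigin N) := by
  intro l hl l' hl' e
  simp only [Prod.mk.injEq] at e
  obtain ⟨e1, et⟩ := e
  have h0 := getD_zero_of_mem hl
  have h0' := getD_zero_of_mem hl'
  rw [mem_sawLists_iff] at hl hl'
  obtain ⟨hc, -, hlen, hn⟩ := hl
  obtain ⟨hc', -, hlen', hn'⟩ := hl'
  have key : ∀ i, i < N + 1 → l.getD i hvOrigin = l'.getD i hvOrigin := by
    intro i
    induction i using Nat.strong_induction_on with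
    | _ i ih =>
    intro hi
    obtain _ | _ | m := i
    · rw [h0, h0']
    · rw [List.getD_eq_getElem?_getD, List.getD_eq_getElem?_getD, e1]
    · have hu := ih m (by omega) (by omega)
      have hv := ih (m + 1) (by omega) (by omega)
      have huv := adj_getD hc (i := m) (by omega)
      have hvw := adj_getD hc (i := m + 1) (by omega)
      have hvw' := adj_getD hc' (i := m + 1) (by omega)
      have huw := getD_ne_getD_add_two hn (i := m) (by omega)
      have huw' := getD_ne_getD_add_two hn' (i := m) (by omega)
      have ht := congrArg (fun t : List Bool => t[m]?) et
      rw [getElem?_turnWord l m (by omega), getElem?_turnWord l' m (by omega), Option.some.injEq, ← hu, ← hv]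
        at ht
      rw [show m + 1 + 1 = m + 2 from rfl] at hvw hvw' ⊢
      rw [← hv] at hvw'
      rw [← hu] at huw'
      exact eq_of_turn_eq huv hvw hvw' huw huw' ht
  exact List.ext_getElem (by rw [hlen, hlen']) fun i h1 h2 => by
    rw [List.getElem_eq_getD hvOrigin, List.getElem_eq_getD hvOrigin]; exact key i (by rw [← hlen]; exact h1)

/-- **The code lands in `firstOpts × capWords (N-1)`**. [folklore] -/
private theorem code_mem (hl : l ∈ sawLists hvGraph hvOrigin N) : l[1]? ∈ firstOpts ∧ turnWord l ∈ capWords (N - 1) := by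
  have h0 := getD_zero_of_mem hl
  rw [mem_sawLists_iff] at hl
  obtain ⟨hc, -, hlen, hn⟩ := hl
  constructor
  · rw [firstOpts, Finset.mem_insert, List.mem_toFinset, List.mem_map]
    rcases Nat.eq_zero_or_pos N with rfl | hN
    · left; exact List.getElem?_eq_none (by omega)
    · right
      refine ⟨l.getD 1 hvOrigin, ?_, ?_⟩
      · have := adj_getD hc (i := 0) (by omega)
        rw [h0] at this
        exact (hvGraph_adj_iff_mem_nbrs _ _).1 this
      · rw [List.getElem?_eq_getElem (show 1 < l.length by omega), List.getElem_eq_getD hvOrigin]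
  · rw [mem_capWords, length_turnWord, hlen]
    exact ⟨by omega, runs_turnWord_le_four _ l le_rfl hc hn⟩

end Code

/-! ### §6 Maximal runs of three equal turns are deletion sites, up to six exceptions (stub S2) -/

section Sites

variable {l : List HV}

/-- The credited indices: first coordinates of deletion sites, and indices of vertices adjacent to an endpoint
of the walk. [folklore] -/
def credit (l : List HV) : Finset ℕ :=
  (hexSharp l).image Prod.fst ∪
    (range l.length).filter (fun i => hvGraph.Adj (l.getD 0 hvOrigin) (l.getD i hvOrigin)) ∪
    (range l.length).filter (fun i => hvGraph.Adj (l.getD (l.length - 1) hvOrigin) (l.getD i hvOrigin))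

/-- A vertex of `ℍ` has at most three neighbours. [folklore] -/
private theorem card_nbrs_toFinset_le (u : HV) : #((nbrs u).toFinset) ≤ 3 := by
  refine (List.toFinset_card_le _).trans ?_
  obtain ⟨a, b, c⟩ := u
  cases c <;> simp [nbrs]

/-- At most three indices carry a neighbour of a given vertex. [folklore] -/
private theorem card_filter_adj_le (hn : l.Nodup) (u : HV) :
    #((range l.length).filter fun i => hvGraph.Adj u (l.getD i hvOrigin)) ≤ 3 := by
  refine le_trans (Finset.card_le_card_of_injOn (fun i => l.getD i hvOrigin) (fun i hi => ?_)
    (fun i hi j hj e => ?_)) (card_nbrs_toFinset_le u)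
  · have hi' : i ∈ (range l.length).filter fun i => hvGraph.Adj u (l.getD i hvOrigin) := by simpa using hi
    rw [mem_filter] at hi'
    simpa [List.mem_toFinset, hvGraph_adj_iff_mem_nbrs] using hi'.2
  · have hi' : i ∈ (range l.length).filter fun i => hvGraph.Adj u (l.getD i hvOrigin) := by simpa using hi
    have hj' : j ∈ (range l.length).filter fun i => hvGraph.Adj u (l.getD i hvOrigin) := by simpa using hj
    rw [mem_filter, mem_range] at hi' hj'
    exact getD_inj hn hi'.1 hj'.1 e

/-- `#credit ≤ J + 6`. [folklore] -/
private theorem card_credit_le (hn : l.Nodup) : #(credit l) ≤ #(hexSharp l) + 6 := by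
  have h1 := card_filter_adj_le hn (l.getD 0 hvOrigin)
  have h2 := card_filter_adj_le hn (l.getD (l.length - 1) hvOrigin)
  have h3 : #((hexSharp l).image Prod.fst) ≤ #(hexSharp l) := card_image_le
  have := card_union_le ((hexSharp l).image Prod.fst ∪
    (range l.length).filter (fun i => hvGraph.Adj (l.getD 0 hvOrigin) (l.getD i hvOrigin)))
    ((range l.length).filter (fun i => hvGraph.Adj (l.getD (l.length - 1) hvOrigin) (l.getD i hvOrigin)))
  have := card_union_le ((hexSharp l).image Prod.fst)
    ((range l.length).filter (fun i => hvGraph.Adj (l.getD 0 hvOrigin) (l.getD i hvOrigin)))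
  rw [credit]; omega

/-- Arithmetic of `Fin 6` used below. [folklore] -/
private theorem fin6_five_add_one : ∀ i : Fin 6, i + 5 + 1 = i := by decide

/-- Arithmetic of `Fin 6` used below. [folklore] -/
private theorem fin6_sub_one : ∀ i : Fin 6, i - 1 = i + 5 := by decide

/-- The turn letter read off an oriented hexagon frame. [folklore] -/
private theorem decide_turn_hexW (c : Bool) (F : ℤ × ℤ) (i : Fin 6) :
    decide (0 < turn (hexW c F (i - 1)) (hexW c F i) (hexW c F (i + 1))) = c := by
  rw [turn_hexW]; cases c <;> simp [sgn]

/-- **Core of S2**: a MAXIMAL run of exactly three letters `c` at the turn positions `k, k+1, k+2` (vertices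
`k+1, k+2, k+3`) is credited: either the sixth vertex `z` of its hexagon is unvisited (`(k, z)` is a deletion
site), or `z` is an endpoint of the walk adjacent to `ω_k`; an interior visit of `z` would extend the run.
[cite: MadrasSlade1993, §7.3 p. 244 (the pattern `V`)] -/
theorem core (hc : l.IsChain hvGraph.Adj) (hn : l.Nodup) {k : ℕ} {c : Bool} (hk : k + 4 < l.length)
    (ht : ∀ q ≤ 2, (turnWord l)[k + q]? = some c) (hb : k = 0 ∨ (turnWord l)[k - 1]? ≠ some c)
    (ha : (turnWord l)[k + 3]? ≠ some c) : k ∈ credit l := by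
  obtain ⟨j, hj⟩ := run_frame hc hn k 2 (by omega) ht
  set F := faceOf c (l.getD k hvOrigin) (l.getD (k + 1) hvOrigin) with hF
  have e0 : l.getD k hvOrigin = hexW c F j := by simpa using hj 0 (by norm_num)
  have e1 : l.getD (k + 1) hvOrigin = hexW c F (j + 1) := by simpa using hj 1 (by norm_num)
  have e3 : l.getD (k + 3) hvOrigin = hexW c F (j + 3) := by simpa using hj 3 (by norm_num)
  have e4 : l.getD (k + 4) hvOrigin = hexW c F (j + 4) := by simpa using hj 4 (by norm_num)
  clear_value F
  set z := hexW c F (j + 5) with hz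
  have hzk : hvGraph.Adj (l.getD k hvOrigin) z := by
    have := adj_hexW_succ c F (j + 5)
    rw [fin6_five_add_one, ← e0] at this
    exact this.symm
  have hz4 : hvGraph.Adj z (l.getD (k + 4) hvOrigin) := by
    have := adj_hexW_succ c F (j + 4)
    rw [show j + 4 + 1 = j + 5 by ring, ← e4] at this
    exact this.symm
  by_cases hzl : z ∈ l
  · obtain ⟨m, hm, hmz⟩ := exists_getD_eq_of_mem hzl
    rcases Nat.eq_zero_or_pos m with rfl | hm0
    · refine mem_union_left _ (mem_union_right _ ?_)
      rw [mem_filter, mem_range]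
      exact ⟨by omega, by rw [hmz]; exact hzk.symm⟩
    by_cases hmN : m = l.length - 1
    · refine mem_union_right _ ?_
      rw [mem_filter, mem_range]
      exact ⟨by omega, by rw [← hmN, hmz]; exact hzk.symm⟩
    exfalso
    have hp : hvGraph.Adj z (l.getD (m - 1) hvOrigin) := by
      have := adj_getD hc (i := m - 1) (by omega)
      rw [show m - 1 + 1 = m by omega, hmz] at this
      exact this.symm
    have hs : hvGraph.Adj z (l.getD (m + 1) hvOrigin) := by
      have := adj_getD hc (i := m) (by omega)
      rw [hmz] at this
      exact this
    have hne : l.getD (m - 1) hvOrigin ≠ l.getD (m + 1) hvOrigin := fun e => by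
      have := getD_inj hn (by omega) (by omega) e; omega
    rw [hz, adj_hexW_iff, fin6_five_add_one, show j + 5 - 1 = j + 4 by ring, ← e0, ← e4] at hp hs
    rcases hp with hp | hp | hp
    · -- `ω_{m-1} = ω_k`: then `ω_{k+1} = z`, two distinct frame vertices coincide
      have := getD_inj hn (by omega) (by omega) hp
      have hm1 : m = k + 1 := by omega
      rw [hm1, e1, hz] at hmz
      exact absurd (add_left_cancel (hexW_injective c F hmz)) (by decide)
    · -- `ω_{m-1} = ω_{k+4}`: then `ω_{k+5} = z` and the turn at `k+4` has the letter `c`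
      have := getD_inj hn (by omega) (by omega) hp
      have hm5 : m = k + 5 := by omega
      apply ha
      rw [getElem?_turnWord l (k + 3) (by omega), show k + 3 + 1 = k + 4 from rfl,
        show k + 3 + 2 = k + 5 from rfl, e3, e4, ← hm5, hmz, hz, Option.some.injEq]
      have key := decide_turn_hexW c F (j + 4)
      rwa [show j + 4 - 1 = j + 3 by ring, show j + 4 + 1 = j + 5 by ring] at key
    · rcases hs with hs | hs | hs
      · -- `ω_{m+1} = ω_k`: then `ω_{k-1} = z` and the turn at `k` has the letter `c`
        have := getD_inj hn (by omega) (by omega) hs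
        rcases hb with hk0 | hb
        · omega
        apply hb
        rw [getElem?_turnWord l (k - 1) (by omega), show k - 1 + 1 = k by omega, show k - 1 + 2 = k + 1 by omega,
          show k - 1 = m by omega, hmz, e0, e1, hz, Option.some.injEq]
        have key := decide_turn_hexW c F j
        rwa [fin6_sub_one] at key
      · -- `ω_{m+1} = ω_{k+4}`: then `ω_{k+3} = z`
        have := getD_inj hn (by omega) (by omega) hs
        have hm3 : m = k + 3 := by omega
        rw [hm3, e3, hz] at hmz
        exact absurd (add_left_cancel (hexW_injective c F hmz)) (by decide)
      · -- both walk-neighbours of `z` are its exterior neighbour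
        exact hne (hp.trans hs.symm)
  · exact mem_union_left _ (mem_union_left _ (mem_image.2 ⟨(k, z), mem_hexSharp.2 ⟨hk, hzk, hz4, hzl⟩, rfl⟩))

/-- **Peeling induction for S2**: from a run start `k` on, the number of maximal runs of length exactly three
of the turn word is at most the number of credited indices `≥ k`. [folklore] -/
private theorem count_runs_drop_le (hc : l.IsChain hvGraph.Adj) (hn : l.Nodup) :
    ∀ (d k : ℕ), (turnWord l).length - k ≤ d → (k = 0 ∨ (turnWord l)[k - 1]? ≠ (turnWord l)[k]?) →
      (runs ((turnWord l).drop k)).count 3 ≤ #((credit l).filter fun i => k ≤ i)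
  | 0, k, hd, _ => by
    rw [List.drop_of_length_le (by omega)]; simp [runs]
  | d + 1, k, hd, hb => by
    by_cases hk : (turnWord l).length ≤ k
    · rw [List.drop_of_length_le hk]; simp [runs]
    obtain ⟨c, hc'⟩ : ∃ c, ((turnWord l).drop k).head? = some c :=
      ⟨(turnWord l)[k]'(by omega), by rw [List.head?_drop]; exact List.getElem?_eq_getElem (by omega)⟩
    have hkc : (turnWord l)[k]? = some c := by rw [← List.head?_drop]; exact hc'
    have hruns := runs_eq_runLen_cons hc'
    obtain ⟨r, hr⟩ : ∃ r, runLen c ((turnWord l).drop k) = r := ⟨_, rfl⟩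
    have hr1 : 1 ≤ r := hr ▸ one_le_runLen hc'
    have hru : r ≤ ((turnWord l).drop k).length := hr ▸ runLen_le_length c _
    rw [List.length_drop] at hru
    have hsplit := eq_replicate_runLen_append c ((turnWord l).drop k)
    have hhead := head?_drop_runLen c ((turnWord l).drop k)
    rw [hr] at hsplit hhead hruns
    rw [List.drop_drop] at hsplit hhead hruns
    -- letters inside the run and just after it
    have hin : ∀ q < r, (turnWord l)[k + q]? = some c := by
      intro q hq
      have : ((turnWord l).drop k)[q]? = some c := by
        rw [hsplit, List.getElem?_append_left (by simp; omega), List.getElem?_replicate]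
        simp [hq]
      rwa [List.getElem?_drop] at this
    have hafter : (turnWord l)[k + r]? ≠ some c := by rwa [List.head?_drop] at hhead
    -- induction hypothesis at the next run start `k + r`
    have ih := count_runs_drop_le hc hn d (k + r) (by omega)
      (Or.inr (by rw [show k + r - 1 = k + (r - 1) by omega, hin (r - 1) (by omega)]; exact fun e => hafter e.symm))
    have hmono : #((credit l).filter fun i => k + r ≤ i) ≤ #((credit l).filter fun i => k ≤ i) := by
      refine card_le_card fun i hi => ?_
      rw [mem_filter] at hi ⊢
      exact ⟨hi.1, by omega⟩
    rw [hruns, List.count_cons]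
    by_cases h3 : r = 3
    · subst h3
      have hkc : k ∈ credit l :=
        core hc hn (by have := length_turnWord l; omega) (fun q hq => hin q (by omega))
          (hb.imp id fun h => by rwa [hkc] at h) hafter
      have hsub : insert k ((credit l).filter fun i => k + 3 ≤ i) ⊆ (credit l).filter fun i => k ≤ i := by
        intro i hi
        rw [mem_insert] at hi
        rw [mem_filter]
        rcases hi with rfl | hi
        · exact ⟨hkc, le_rfl⟩
        · rw [mem_filter] at hi; exact ⟨hi.1, by omega⟩
      have hcard := card_le_card hsub
      rw [card_insert_of_notMem (by simp)] at hcard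
      simp only [beq_self_eq_true, ↓reduceIte]
      omega
    · simp only [show (r == 3) = false from by simp [h3], Bool.false_eq_true, ↓reduceIte, add_zero]
      exact ih.trans hmono

/-- **S2 «maximal 3-runs are deletion sites»**: `R3 (turnWord ω) ≤ J(ω) + 6`. [cite: MadrasSlade1993, §7.3 p. 244] -/
theorem R3_le_card_hexSharp (hc : l.IsChain hvGraph.Adj) (hn : l.Nodup) :
    R3 (turnWord l) ≤ #(hexSharp l) + 6 := by
  have h := count_runs_drop_le hc hn ((turnWord l).length) 0 (by omega) (Or.inl rfl)
  rw [List.drop_zero] at h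
  exact h.trans ((card_le_card (filter_subset _ _)).trans (card_credit_le hn))

end Sites

/-! ### §7 Markov, the numeric input, and the composition (a-idea-1's skeleton d6c6281c, constants `2`, `8·10⁶`) -/

section Compose

/-- Markov/Chernoff on a finset: `#{f ≤ k} · x^k ≤ Σ x^{f}` for `0 < x ≤ 1`. [folklore] -/
private theorem card_filter_mul_pow_le {α : Type*} (s : Finset α) (f : α → ℕ) {x : ℝ} (hx0 : 0 < x) (hx1 : x ≤ 1)
    (k : ℕ) : ((s.filter fun a => f a ≤ k).card : ℝ) * x ^ k ≤ ∑ a ∈ s, x ^ f a := by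
  classical
  calc ((s.filter fun a => f a ≤ k).card : ℝ) * x ^ k = ∑ a ∈ s.filter (fun a => f a ≤ k), x ^ k := by
        rw [Finset.sum_const, nsmul_eq_mul]
    _ ≤ ∑ a ∈ s.filter (fun a => f a ≤ k), x ^ f a := by
        refine Finset.sum_le_sum fun a ha => ?_
        exact pow_le_pow_of_le_one hx0.le hx1 (Finset.mem_filter.1 ha).2
    _ ≤ ∑ a ∈ s, x ^ f a :=
        Finset.sum_le_sum_of_subset_of_nonneg (Finset.filter_subset _ _) fun a _ _ => pow_nonneg hx0.le _

/-- **The one numeric input, certified**: `(178/100)^200 · 10 · 16 ≤ √(2+√2)^200` (`√2 ≥ 1.41421`, then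
`(1.78)^200 · 160 ≤ (3.41421)^100` by `norm_num`; in logarithms `120.40 ≤ 122.79`). [folklore] -/
private theorem hex_numeric : (178 / 100 : ℝ) ^ 200 * 10 * 16 ≤ Real.sqrt (2 + Real.sqrt 2) ^ 200 := by
  have h2 : Real.sqrt 2 ^ 2 = 2 := Real.sq_sqrt (by norm_num)
  have hs2 : (141421 / 100000 : ℝ) ≤ Real.sqrt 2 := by nlinarith [Real.sqrt_nonneg 2, h2]
  have hpos : (0 : ℝ) ≤ 2 + Real.sqrt 2 := by positivity
  have hsq : Real.sqrt (2 + Real.sqrt 2) ^ 200 = (2 + Real.sqrt 2) ^ 100 := by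
    rw [show (200 : ℕ) = 2 * 100 by norm_num, pow_mul, Real.sq_sqrt hpos]
  rw [hsq]
  calc (178 / 100 : ℝ) ^ 200 * 10 * 16 ≤ (341421 / 100000 : ℝ) ^ 100 := by norm_num
    _ ≤ (2 + Real.sqrt 2) ^ 100 := pow_le_pow_left₀ (by norm_num) (by linarith) 100

/-- `#firstOpts = 4`. [folklore] -/
private theorem card_firstOpts : firstOpts.card = 4 := by decide

/-- **The composition** (a-idea-1's checked skeleton, with the S3 constant `2`): injective code into
`firstOpts × capWords (N-1)`, `R3 ≤ J + 6`, the tilted run count and Markov at `x = 1/10`, level `N/200 + 6`,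
and the numeric input give the density face with `Q = 50`, `C = 8·10⁶`.
[cite: MadrasSlade1993, §7.3 (7.3.9)–(7.3.10) (the density input of Theorem 7.3.2, here pattern-free)] -/
theorem detourDensityHex_of
    (h1 : ∀ N : ℕ, Set.InjOn (fun l : List HV => (l[1]?, turnWord l)) (sawLists hvGraph hvOrigin N) ∧
      ∀ l ∈ sawLists hvGraph hvOrigin N, l[1]? ∈ firstOpts ∧ turnWord l ∈ capWords (N - 1))
    (h2 : ∀ (N : ℕ) (l : List HV), l ∈ sawLists hvGraph hvOrigin N → R3 (turnWord l) ≤ #(hexSharp l) + 6)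
    (h3 : ∀ n : ℕ, ∑ w ∈ capWords n, (1 / 10 : ℝ) ^ R3 w ≤ 2 * (178 / 100 : ℝ) ^ n) :
    DetourDensityHex := by
  classical
  refine ⟨50, by norm_num, 8000000, fun N => ?_⟩
  have hk : N / (4 * 50) = N / 200 := by norm_num
  simp only [hk]
  set k := N / 200 with hkdef
  set j := N / 50 with hjdef
  set s := Real.sqrt (2 + Real.sqrt 2) with hsdef
  have hs178 : (178 / 100 : ℝ) ≤ s := by
    have h2 : Real.sqrt 2 ^ 2 = 2 := Real.sq_sqrt (by norm_num)
    have hs2 : (141421 / 100000 : ℝ) ≤ Real.sqrt 2 := by nlinarith [Real.sqrt_nonneg 2, h2]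
    have : (178 / 100 : ℝ) = Real.sqrt ((178 / 100) ^ 2) := by rw [Real.sqrt_sq (by norm_num)]
    rw [this, hsdef]
    exact Real.sqrt_le_sqrt (by nlinarith)
  have hspos : (0 : ℝ) < s := lt_of_lt_of_le (by norm_num) hs178
  -- Step 1: inject the deletion-poor walks into `firstOpts × (R3-poor capped words)`
  set T := (capWords (N - 1)).filter fun w => R3 w ≤ k + 6 with hTdef
  have hS : ({l : List HV | l ∈ sawLists hvGraph hvOrigin N ∧ #(hexSharp l) ≤ k}.ncard : ℕ) ≤
      (firstOpts ×ˢ T).card := by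
    have hfin : (↑(firstOpts ×ˢ T) : Set (Option HV × List Bool)).Finite := Finset.finite_toSet _
    refine (Set.ncard_le_ncard_of_injOn (fun l : List HV => (l[1]?, turnWord l))
      (s := {l : List HV | l ∈ sawLists hvGraph hvOrigin N ∧ #(hexSharp l) ≤ k})
      (t := (↑(firstOpts ×ˢ T) : Set (Option HV × List Bool))) ?_ ?_ hfin).trans_eq (Set.ncard_coe_finset _)
    · intro l hl
      simp only [Set.mem_setOf_eq] at hl
      obtain ⟨hf, hw⟩ := (h1 N).2 l hl.1
      simp only [Finset.coe_product, Set.mem_prod, Finset.mem_coe, hTdef, Finset.mem_filter]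
      exact ⟨hf, hw, (h2 N l hl.1).trans (by omega)⟩
    · exact (h1 N).1.mono fun l hl => hl.1
  have hS' : (({l : List HV | l ∈ sawLists hvGraph hvOrigin N ∧ #(hexSharp l) ≤ k}.ncard : ℕ) : ℝ) ≤
      4 * T.card := by
    have := hS; rw [Finset.card_product, card_firstOpts] at this; exact_mod_cast this
  -- Step 2: Chernoff with x = 1/10 at level k + 6
  have hx0 : (0 : ℝ) < 1 / 10 := by norm_num
  have hx1 : (1 / 10 : ℝ) ≤ 1 := by norm_num
  have hcher := card_filter_mul_pow_le (capWords (N - 1)) R3 hx0 hx1 (k + 6)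
  have hT : (T.card : ℝ) ≤ 2 * (178 / 100 : ℝ) ^ (N - 1) * 10 ^ (k + 6) := by
    have h10 : (1 / 10 : ℝ) ^ (k + 6) * 10 ^ (k + 6) = 1 := by rw [← mul_pow]; norm_num
    have hpos : (0 : ℝ) < 10 ^ (k + 6) := by positivity
    have := mul_le_mul_of_nonneg_right (hcher.trans (h3 (N - 1))) hpos.le
    calc (T.card : ℝ) = (T.card : ℝ) * ((1 / 10 : ℝ) ^ (k + 6) * 10 ^ (k + 6)) := by rw [h10, mul_one]
      _ = (T.card : ℝ) * (1 / 10 : ℝ) ^ (k + 6) * 10 ^ (k + 6) := by ring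
      _ ≤ 2 * (178 / 100 : ℝ) ^ (N - 1) * 10 ^ (k + 6) := by convert this using 1
  -- Step 3: numeric core `(178/100)^N · 10^k · 2^j ≤ s^N` via 200-th powers
  have key : ((178 / 100 : ℝ) ^ N * 10 ^ k * 2 ^ j) ^ 200 ≤ (s ^ N) ^ 200 := by
    have h200k : 200 * k ≤ N := Nat.mul_div_le N 200
    have h50j : 50 * j ≤ N := Nat.mul_div_le N 50
    have h10k : (10 : ℝ) ^ (k * 200) ≤ 10 ^ N := pow_le_pow_right₀ (by norm_num) (by omega)
    have h2j : (2 : ℝ) ^ (j * 200) ≤ 16 ^ N := by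
      rw [show j * 200 = 4 * (j * 50) by ring, pow_mul]
      norm_num
      exact pow_le_pow_right₀ (by norm_num) (by omega)
    calc ((178 / 100 : ℝ) ^ N * 10 ^ k * 2 ^ j) ^ 200
        = ((178 / 100 : ℝ) ^ 200) ^ N * 10 ^ (k * 200) * 2 ^ (j * 200) := by
          rw [mul_pow, mul_pow, ← pow_mul, ← pow_mul, ← pow_mul, mul_comm N 200, pow_mul]
      _ ≤ ((178 / 100 : ℝ) ^ 200) ^ N * 10 ^ N * 16 ^ N := by gcongr
      _ = ((178 / 100 : ℝ) ^ 200 * 10 * 16) ^ N := by rw [mul_pow, mul_pow]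
      _ ≤ (s ^ 200) ^ N := pow_le_pow_left₀ (by positivity) hex_numeric N
      _ = (s ^ N) ^ 200 := by rw [← pow_mul, ← pow_mul, mul_comm]
  have key' : (178 / 100 : ℝ) ^ N * 10 ^ k * 2 ^ j ≤ s ^ N :=
    (pow_le_pow_iff_left₀ (by positivity) (by positivity) (by norm_num : (200 : ℕ) ≠ 0)).1 key
  -- Step 4: assemble
  have hNm : (178 / 100 : ℝ) ^ (N - 1) ≤ (178 / 100 : ℝ) ^ N :=
    pow_le_pow_right₀ (by norm_num) (Nat.sub_le N 1)
  have h12 : (1 / 2 : ℝ) ^ j * 2 ^ j = 1 := by rw [← mul_pow]; norm_num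
  have step : 4 * (2 * (178 / 100 : ℝ) ^ (N - 1) * 10 ^ (k + 6)) * 2 ^ j ≤ 8000000 * s ^ N := by
    have : 4 * (2 * (178 / 100 : ℝ) ^ (N - 1) * 10 ^ (k + 6)) * 2 ^ j ≤
        8000000 * ((178 / 100 : ℝ) ^ N * 10 ^ k * 2 ^ j) := by
      rw [pow_add]
      have h10k0 : (0 : ℝ) ≤ 10 ^ k * 2 ^ j := by positivity
      nlinarith [mul_le_mul_of_nonneg_right hNm h10k0]
    linarith [key']
  calc (({l : List HV | l ∈ sawLists hvGraph hvOrigin N ∧ #(hexSharp l) ≤ k}.ncard : ℕ) : ℝ)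
      ≤ 4 * T.card := hS'
    _ ≤ 4 * (2 * (178 / 100 : ℝ) ^ (N - 1) * 10 ^ (k + 6)) := by linarith [hT]
    _ = 4 * (2 * (178 / 100 : ℝ) ^ (N - 1) * 10 ^ (k + 6)) * 2 ^ j * (1 / 2 : ℝ) ^ j := by
        rw [mul_assoc (4 * (2 * (178 / 100 : ℝ) ^ (N - 1) * 10 ^ (k + 6))), mul_comm ((2 : ℝ) ^ j), h12,
          mul_one]
    _ ≤ 8000000 * s ^ N * (1 / 2 : ℝ) ^ j := mul_le_mul_of_nonneg_right step (by positivity)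
    _ = 8000000 * (1 / 2 : ℝ) ^ j * s ^ N := by ring

end Compose

end RunDensity

/-- **K1′-ℍ «HEX-RUN-DENSITY»: `DetourDensityHex` holds (with `Q = 50`, `C = 8·10⁶`)** — all but at most
`8·10⁶ · 2^{-⌊N/50⌋} · √(2+√2)^N` of the `N`-step self-avoiding walks on the hexagonal lattice have more than
`N/200` hexagon deletion sites `(m, v)` (`ω_m ~ v ~ ω_{m+4}`, `v` unvisited). Proof: the turn word is an
injective code with runs of equal turns capped at four (five equal turns close a hexagon); a maximal run of
exactly three equal turns goes around a hexagon whose sixth vertex is unvisited unless it is an endpoint of the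
walk (an interior visit would extend the run), so `R3 ≤ J + 6`; the tilted run count
`Σ_{runs ≤ 4} (1/10)^{R3} ≤ 2 · 1.78^n` (first-run transfer `1/λ + 1/λ² + x/λ³ + 1/λ⁴ ≤ 1`); Markov; and
`1.78 · 10^{1/200} · 2^{1/50} ≤ √(2+√2) = μ(ℍ)` (Duminil-Copin–Smirnov). This is the entropy input of Kesten's
ratio argument on `ℍ`, obtained WITHOUT a pattern theorem.
[cite: MadrasSlade1993, §7.3 (proof of Theorem 7.3.2; the pattern-theorem input Theorem 7.2.3 is replaced by the
run structure of the turn word); DuminilCopinSmirnov2012, Theorem 1] -/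
theorem detourDensityHex : DetourDensityHex :=
  RunDensity.detourDensityHex_of (fun N => ⟨RunDensity.code_injOn N, fun _ hl => RunDensity.code_mem hl⟩)
    (fun _ _ hl => RunDensity.R3_le_card_hexSharp (mem_sawLists_iff.1 hl).1 (mem_sawLists_iff.1 hl).2.2.2)
    RunDensity.sum_pow_R3_le

/-- Exact-name discharge of the face `DetourDensityHex` of `HexSAWHexagonSurgery` (same-file alias of
`detourDensityHex`, for the facts census). [cite: MadrasSlade1993, §7.3 (proof of Theorem 7.3.2)] -/
theorem DetourDensityHex_holds : DetourDensityHex := detourDensityHex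

end Literature.Probability.RandomPlanarGeometry.SAW.HV
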